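import Mathlib

/-!
# Coprime-degree descent for norm residues modulo `p`-th powers (solo-informed, s19, rung 5)

Abstract form of the step that justifies the unit-norm certificates of Part II §7.11 (14)(f):
let `i : A → A'` ("inclusion of units of `F` into units of `F′`") and `ν : A' → A` ("norm")
satisfy `ν ∘ i = d`, and let `S ≤ A`, `S' ≤ A'` be subgroups ("norms from the Kummer extension")
with `i(S) ≤ S'` and `ν(S') ≤ S`.  If `d` is prime to `p`, then `a ∈ A` is a norm residue
modulo `p`-th powers upstairs (`i a ∈ S' + p A'`) iff it is one downstairs (`a ∈ S + p A`).
At `p = 7`, `d = [F(μ_7) : F] = 6`; at `p = 5`, `d = [F(μ_5) : F(√5)] = 2`.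
-/

namespace Summit.Langlands.Langlands.Theorems

/-- Descent: a norm residue upstairs is a norm residue downstairs when the degree `d` with
`ν ∘ i = d` is prime to `p`. -/
theorem soloInformed_normResidue_descent_of_coprime
    {A A' : Type*} [AddCommGroup A] [AddCommGroup A']
    (i : A →+ A') (ν : A' →+ A) (d p : ℕ) (hνi : ∀ a, ν (i a) = d • a)
    (hcop : Nat.Coprime d p) (S : AddSubgroup A) (S' : AddSubgroup A')
    (hνS : ∀ s' ∈ S', ν s' ∈ S) (a : A)
    (h : ∃ s' ∈ S', ∃ x' : A', i a = s' + p • x') :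
    ∃ s ∈ S, ∃ x : A, a = s + p • x := by
  obtain ⟨s', hs', x', hx'⟩ := h
  obtain ⟨u, v, huv⟩ : IsCoprime (d : ℤ) (p : ℤ) := Nat.isCoprime_iff_coprime.mpr hcop
  have hda : (d : ℤ) • a = ν s' + p • ν x' := by
    rw [natCast_zsmul, ← hνi, hx', map_add, map_nsmul]
  refine ⟨u • ν s', S.zsmul_mem (hνS s' hs') u, u • ν x' + v • a, ?_⟩
  calc a = (1 : ℤ) • a := (one_zsmul a).symm
    _ = (u * d + v * p) • a := by rw [huv]
    _ = u • ((d : ℤ) • a) + v • ((p : ℤ) • a) := by rw [add_zsmul, mul_zsmul, mul_zsmul]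
    _ = u • (ν s' + p • ν x') + v • (p • a) := by rw [hda, natCast_zsmul]
    _ = u • ν s' + p • (u • ν x' + v • a) := by
          rw [smul_add, smul_add, smul_comm u p (ν x'), smul_comm v p a, add_assoc]

/-- Ascent (the easy direction): a norm residue downstairs is one upstairs. -/
theorem soloInformed_normResidue_ascent
    {A A' : Type*} [AddCommGroup A] [AddCommGroup A']
    (i : A →+ A') (p : ℕ) (S : AddSubgroup A) (S' : AddSubgroup A')
    (hiS : ∀ s ∈ S, i s ∈ S') (a : A)
    (h : ∃ s ∈ S, ∃ x : A, a = s + p • x) :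
    ∃ s' ∈ S', ∃ x' : A', i a = s' + p • x' := by
  obtain ⟨s, hs, x, hx⟩ := h
  exact ⟨i s, hiS s hs, i x, by rw [hx, map_add, map_nsmul]⟩

/-- The certificate equivalence: for `d` prime to `p`, norm residues modulo `p`-th powers
are detected equally upstairs and downstairs. -/
theorem soloInformed_normResidue_iff_of_coprime
    {A A' : Type*} [AddCommGroup A] [AddCommGroup A']
    (i : A →+ A') (ν : A' →+ A) (d p : ℕ) (hνi : ∀ a, ν (i a) = d • a)
    (hcop : Nat.Coprime d p) (S : AddSubgroup A) (S' : AddSubgroup A')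
    (hiS : ∀ s ∈ S, i s ∈ S') (hνS : ∀ s' ∈ S', ν s' ∈ S) (a : A) :
    (∃ s' ∈ S', ∃ x' : A', i a = s' + p • x') ↔ (∃ s ∈ S, ∃ x : A, a = s + p • x) :=
  ⟨soloInformed_normResidue_descent_of_coprime i ν d p hνi hcop S S' hνS a,
   soloInformed_normResidue_ascent i p S S' hiS a⟩

end Summit.Langlands.Langlands.Theorems
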